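import Mathlib.Topology.Homeomorph.Lemmas
import Literature.AnabelianGeometry.AbsoluteAnabelian.AbsTopIThm26UniversalClosuresRefuted
import Literature.AnabelianGeometry.AbsoluteAnabelian.AbsTopIThm26iiProSigmaProofs
import Literature.AnabelianGeometry.AbsoluteAnabelian.CoinvariantRankProofs
import Literature.AnabelianGeometry.AbsoluteAnabelian.FreeProlRankLinearProofs
import Literature.AnabelianGeometry.AbsoluteAnabelian.GaloisSubextensionProofs
import Literature.AnabelianGeometry.AbsoluteAnabelian.ZHatCompletionFreeProcyclic
import Literature.AnabelianGeometry.SemiGraphs.ProSigmaPuncturedSurfaceElastic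
import Literature.AnabelianGeometry.SemiGraphs.ProSigmaCompletionTFG
import Literature.AnabelianGeometry.SemiGraphs.ProSigmaCompletionModels
import HarnessLib

/-!
# [AbsTopI] Thm 2.6 (i), (ii), (iv) AS TYPED: instance forms with a NON-DEGENERATE `Δ` —
# `Δ` a pro-`Σ` completion of a finitely generated group (PROOF-ONLY)

S. Mochizuki, *Topics in Absolute Anabelian Geometry I: Generalities*, J. Math. Sci. Univ. Tokyo
**19** (2012) [AbsTopI], Thm 2.6 (i) p. 21, (ii) p. 21, (iv) p. 22 (manuscript pagination, lit key
`paper:url-11ac98ba15fc`) [cite: MochizukiAbsTopI2012, Thm 2.6 pp.21-22].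

The statement file `AbsTopISemiAbsolute.lean` (abc-iut-L4-t4) types the three items as PREDICATES
`FundamentalExtension.Thm26i`, `Thm26ii B Σ`, `Thm26iv Σ` on an ABSTRACT extension of profinite
groups `1 → Δ → Π → G → 1` (FACT-LIST rows F-0246, F-0247, F-0248 of the abc-iut cell; kernel
closedness = parametrised).  `AbsTopIThm26UniversalClosuresRefuted.lean` REFUTED their universal
closures and proved instance forms at the POINT extensions (`Δ = 1`).  This proof-only sequel (no
definition, no instance, no named fact) proves instance forms in which `Δ` is the honest object of
print — "the maximal pro-`Σ` quotient" of the topological fundamental group of a hyperbolic curve is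
the pro-`Σ` completion of a finitely generated group (`Γ_{g,r}`; a free group `F_n` when `r ≥ 1`) —:

* **(iv), model class of print** — `FundamentalExtension.MLFBase.thm26iv_of_isProSigmaCompletion` =
  `thm26iv_holds`: for EVERY extension with MLF base data `G ≅ G_k` whose `Δ` carries a pro-`Σ`
  completion structure `ι : Γ → Δ` of a finitely generated group `Γ` (abc-iut-L3's interface
  `IsProSigmaCompletion`), `Σ ⊆ Primes`, the typed (iv) HOLDS — Prop 2.2 at the model
  (`geomTFG_of_isProSigmaCompletion`), "`Δ` pro-`Σ`" from the completion structure, elasticity of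
  `G_k` ([AbsTopI] Thm 1.7 (ii), the tree's `MLFBase.isElastic_gal`) via `MLFBase.thm26iv`.  This
  covers the extensions "of GSAFG-type" of print (whose `Δ` IS such a completion) with no hypothesis
  on the outer Galois action — (iv) does not use it;
* **product ranks** — `freeProlRank_add_le_prod` (`δ¹_l(A) + δ¹_l(B) ≤ δ¹_l(A × B)`: append two
  continuous surjections onto `ℤ_l^a`, `ℤ_l^b`), `freeProlRank_prod_le_add_card`
  (`δ¹_l(A × B) ≤ δ¹_l(B) + |s|` for a finite topological generating set `s` of `A`, from
  abc-iut-L4-d3's `freeProlRank_le_add_card_of_generators`), whence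
  `freeProlRank_prod_eq_add_of_isProSigmaCompletion_freeGroup`: `δ¹_l(F̂_n^Σ × B) = δ¹_l(B) + n` for
  `l ∈ Σ` (`δ¹_l(F̂_n^Σ) = n`, abc-iut-L3's `freeProlRank_eq_card_of_isProSigmaCompletion_freeGroup`);
* **(ii)/(iv) at the SPLIT model** `Π := Δ̂ × G_k ↠ G_k` (second projection), `Δ̂` a pro-`Σ`
  completion of `F_n` — `thm26iv_split_of_isProSigmaCompletion` (any f.g. `Γ`, `Σ ⊆ Primes`) and
  `thm26ii_split_of_isProSigmaCompletion_freeGroup` (every `Σ`; the printed rank identity holds with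
  `dim Q = n`: `δ¹_l(Π) = δ¹_l(G) + n` for `l ∈ Σ`, `= δ¹_l(G)` for `l ∉ Σ`), the latter GIVEN the
  topological finite generation of `G_k` ([NSW] 7.5.10 — a theorem of the tree, but Summits-side:
  `Summits/ABC/IUTFork/MLFGaloisTFG.lean`; the unconditional form `thm26ii_holds` is assembled there);
  specialisations `thm26iv_split_profiniteCompletion_freeGroup` /
  `thm26ii_split_profiniteCompletion_freeGroup` at `Δ̂ = F̂_n` = Mathlib's profinite completion
  (`Σ = Primes`, the case of [IUTchI–III]; `F̂₂` is [EtTh]'s model of `Δ_X`,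
  `Literature.AnabelianGeometry.EtaleTheta.F₂hat`);
* **(i) at `Π = G = Ẑ`** (Mathlib's profinite completion of `ℤ`, free procyclic by the tree's
  `isFreeProcyclic_zHatCompletion`; `≅ Gal(k̄/k)` for `k` finite, `isFreeProcyclic_absoluteGaloisGroup_
  of_finite`), `Δ = 1` — `thm26i_holds`: the typed (i) at `X = Spec 𝔽_q`.

HONEST FRAMING.  The split model `Δ̂ × G_k` is an ABSTRACT extension (trivial outer action): it is
NOT the extension `1 → Δ_X → Π_X → G_k → 1` of a hyperbolic curve (whose outer Galois representation
is non-trivial) — it is a satisfiability witness of the typed (ii) with a non-degenerate `Δ`, and for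
(ii) the printed "`dim_{ℚ_l}(Q_l ⊗ ℚ_l)`" is realised as `n` rather than the curve's value.  The
model-class theorem for (iv) is genuine: it needs nothing about the action.  A refuted universal
closure (sibling file) says the rows are HYPOTHESES ON DATA, not that anything in print is false;
[AbsTopI] is refereed and undisputed; nothing here bears on [IUTchIII] Cor. 3.12 or takes a side;
typed ≠ proved elsewhere.  Theorems only; axioms standard.
-/

noncomputable section

open Topology Field

namespace Literature.AnabelianGeometry.AbsoluteAnabelian

open Literature.AnabelianGeometry.SemiGraphs.SemiGraphOfAnabelioids

universe u v

/-! ### Free pro-`l` ranks of products -/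

section ProductRank

variable {A : Type u} [Group A] [TopologicalSpace A]
variable {B : Type v} [Group B] [TopologicalSpace B]

/-- Unfolding of `a ≤ δ¹_l(A)`: a continuous surjection `A ↠ ℤ_l^N` with `a ≤ N` (for `a = 0` the
trivial map to `ℤ_l^0`). [cite: MochizukiAbsTopI2012, Thm 2.6 p.21] -/
private theorem exists_surjective_ge_of_le_freeProlRank (l : ℕ) [Fact l.Prime] {a : ℕ}
    (ha : (a : ℕ∞) ≤ freeProlRank A l) :
    ∃ (N : ℕ) (F : A →ₜ* Multiplicative (Fin N → ℤ_[l])), a ≤ N ∧ Function.Surjective F := by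
  rcases Nat.eq_zero_or_pos a with rfl | ha0
  · refine ⟨0, ⟨1, continuous_const⟩, le_rfl, fun y => ⟨1, ?_⟩⟩
    apply Multiplicative.toAdd.injective
    funext i
    exact i.elim0
  · exact exists_surjective_of_le_freeProlRank l ha0 ha

/-- `Fin.append` is additive in both arguments. [folklore] -/
private theorem fin_append_add {α : Type*} [Add α] {m n : ℕ} (u₁ u₂ : Fin m → α)
    (v₁ v₂ : Fin n → α) :
    Fin.append (u₁ + u₂) (v₁ + v₂) = Fin.append u₁ v₁ + Fin.append u₂ v₂ := by
  funext i
  refine Fin.addCases (fun j => ?_) (fun j => ?_) i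
  · simp only [Pi.add_apply, Fin.append_left]
  · simp only [Pi.add_apply, Fin.append_right]

/-- **`a ≤ δ¹_l(A)` and `b ≤ δ¹_l(B)` imply `a + b ≤ δ¹_l(A × B)`**: append a continuous surjection
`A ↠ ℤ_l^M` (`a ≤ M`) and one `B ↠ ℤ_l^N` (`b ≤ N`) to `A × B ↠ ℤ_l^{M+N}`.
[cite: MochizukiAbsTopI2012, Thm 2.6 p.21] -/
theorem natCast_add_le_freeProlRank_prod (l : ℕ) [Fact l.Prime] {a b : ℕ}
    (ha : (a : ℕ∞) ≤ freeProlRank A l) (hb : (b : ℕ∞) ≤ freeProlRank B l) :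
    ((a + b : ℕ) : ℕ∞) ≤ freeProlRank (A × B) l := by
  obtain ⟨M, F, haM, hF⟩ := exists_surjective_ge_of_le_freeProlRank l ha
  obtain ⟨N, G, hbN, hG⟩ := exists_surjective_ge_of_le_freeProlRank l hb
  -- `(x, y) ↦ (F x, G y) ∈ ℤ_l^{M+N}`
  let Φ : A × B →ₜ* Multiplicative (Fin (M + N) → ℤ_[l]) :=
    { toFun := fun x => Multiplicative.ofAdd
        (Fin.append (Multiplicative.toAdd (F x.1)) (Multiplicative.toAdd (G x.2)))
      map_one' := by
        simp only [Prod.fst_one, Prod.snd_one, map_one, toAdd_one]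
        change Multiplicative.ofAdd _ = Multiplicative.ofAdd 0
        congr 1
        funext i
        refine Fin.addCases (fun j => ?_) (fun j => ?_) i
        · rw [Fin.append_left, Pi.zero_apply, Pi.zero_apply]
        · rw [Fin.append_right, Pi.zero_apply, Pi.zero_apply]
      map_mul' := fun x y => by
        rw [← ofAdd_add]
        congr 1
        simp only [Prod.fst_mul, Prod.snd_mul, map_mul, toAdd_mul, fin_append_add]
      continuous_toFun := continuous_ofAdd.comp ((Fin.continuous_append M N).comp
        ((continuous_toAdd.comp ((map_continuous F).comp continuous_fst)).prodMk
          (continuous_toAdd.comp ((map_continuous G).comp continuous_snd)))) }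
  have hΦ_apply : ∀ x : A × B, Multiplicative.toAdd (Φ x) =
      Fin.append (Multiplicative.toAdd (F x.1)) (Multiplicative.toAdd (G x.2)) := fun _ => rfl
  have hΦ : Function.Surjective Φ := by
    intro y
    obtain ⟨a', ha'⟩ := hF (Multiplicative.ofAdd fun i => Multiplicative.toAdd y (Fin.castAdd N i))
    obtain ⟨b', hb'⟩ := hG (Multiplicative.ofAdd fun i => Multiplicative.toAdd y (Fin.natAdd M i))
    refine ⟨(a', b'), ?_⟩
    apply Multiplicative.toAdd.injective
    rw [hΦ_apply]
    change Fin.append (Multiplicative.toAdd (F a')) (Multiplicative.toAdd (G b')) = _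
    rw [ha', hb', toAdd_ofAdd, toAdd_ofAdd]
    exact Fin.append_castAdd_natAdd
  calc ((a + b : ℕ) : ℕ∞) ≤ ((M + N : ℕ) : ℕ∞) := by exact_mod_cast Nat.add_le_add haM hbN
    _ ≤ freeProlRank (A × B) l := le_freeProlRank_of_surjective l Φ hΦ

/-- **`δ¹_l(A) + δ¹_l(B) ≤ δ¹_l(A × B)`** (in `ℕ∞`). [cite: MochizukiAbsTopI2012, Thm 2.6 p.21] -/
theorem freeProlRank_add_le_prod (l : ℕ) [Fact l.Prime] :
    freeProlRank A l + freeProlRank B l ≤ freeProlRank (A × B) l := by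
  have hA : freeProlRank A l ≤ freeProlRank (A × B) l :=
    freeProlRank_le_of_surjective (ContinuousMonoidHom.fst A B) Prod.fst_surjective l
  have hB : freeProlRank B l ≤ freeProlRank (A × B) l :=
    freeProlRank_le_of_surjective (ContinuousMonoidHom.snd A B) Prod.snd_surjective l
  rcases eq_or_ne (freeProlRank A l) ⊤ with hAt | hAt
  · rw [hAt, top_le_iff] at hA
    rw [hA]
    exact le_top
  rcases eq_or_ne (freeProlRank B l) ⊤ with hBt | hBt
  · rw [hBt, top_le_iff] at hB
    rw [hB]
    exact le_top
  obtain ⟨a, ha⟩ := ENat.ne_top_iff_exists.mp hAt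
  obtain ⟨b, hb⟩ := ENat.ne_top_iff_exists.mp hBt
  rw [← ha, ← hb]
  exact_mod_cast natCast_add_le_freeProlRank_prod l ha.le hb.le

variable [IsTopologicalGroup A] [CompactSpace A] [IsTopologicalGroup B] [CompactSpace B] [T2Space B]

/-- **`δ¹_l(A × B) ≤ δ¹_l(B) + |s|`** for a finite subset `s ⊆ A` generating a dense subgroup of
`A`: the kernel `A × 1` of the second projection is topologically generated by `s × 1`, so
abc-iut-L4-d3's `freeProlRank_le_add_card_of_generators` (characters vanishing on the generators
vanish on the kernel; rank–nullity) applies. [cite: MochizukiAbsAnab2004, Lemma 1.1.4 (ii) p.7] -/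
theorem freeProlRank_prod_le_add_card (l : ℕ) [Fact l.Prime] (s : Finset A)
    (hs : (Subgroup.closure (s : Set A)).topologicalClosure = ⊤) :
    freeProlRank (A × B) l ≤ freeProlRank B l + s.card := by
  classical
  -- the kernel of the second projection and the embedding `A → Ker(snd)`, `a ↦ (a, 1)`
  let D : Subgroup (A × B) := (ContinuousMonoidHom.snd A B).toMonoidHom.ker
  have hmemD : ∀ x : A × B, x ∈ D ↔ (ContinuousMonoidHom.snd A B) x = 1 := fun _ => Iff.rfl
  let j : A →ₜ* D :=
    { toFun := fun a => ⟨(a, 1), (hmemD _).mpr rfl⟩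
      map_one' := rfl
      map_mul' := fun a b => Subtype.ext (Prod.ext rfl (mul_one (1 : B)).symm)
      continuous_toFun := Continuous.subtype_mk (continuous_id.prodMk continuous_const) _ }
  have hjsurj : Function.Surjective j := by
    intro d
    have hd2 : ((d : A × B)).2 = 1 := (hmemD d).mp d.2
    exact ⟨(d : A × B).1, Subtype.ext (Prod.ext rfl hd2.symm)⟩
  -- the generators pushed into the kernel
  let s' : Finset D := s.image j
  have hcl : Subgroup.closure (s' : Set D) = (Subgroup.closure (s : Set A)).map j.toMonoidHom := by
    rw [Finset.coe_image, MonoidHom.map_closure]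
    rfl
  have hsd : Dense ((Subgroup.closure (s : Set A)) : Set A) := by
    rw [dense_iff_closure_eq, ← Subgroup.topologicalClosure_coe, hs, Subgroup.coe_top]
  have hs' : (Subgroup.closure (s' : Set D)).topologicalClosure = ⊤ := by
    rw [← SetLike.coe_set_eq, Subgroup.topologicalClosure_coe, Subgroup.coe_top, hcl,
      Subgroup.coe_map]
    refine dense_iff_closure_eq.mp ?_
    have h := hjsurj.denseRange.comp hsd.denseRange_val (map_continuous j)
    rw [DenseRange, Set.range_comp, Subtype.range_coe] at h
    exact h
  have hcard : s'.card ≤ s.card := Finset.card_image_le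
  calc freeProlRank (A × B) l ≤ freeProlRank B l + s'.card :=
        freeProlRank_le_add_card_of_generators (ContinuousMonoidHom.snd A B) Prod.snd_surjective D
          hmemD s' hs' l
    _ ≤ freeProlRank B l + s.card := add_le_add le_rfl (by exact_mod_cast hcard)

/-- **`δ¹_l(A × B) = δ¹_l(B) + n`** when `n ≤ δ¹_l(A)` and `A` has a dense subgroup generated by at
most `n` elements (so that `δ¹_l(A) = n` is attained by generators). [cite: MochizukiAbsTopI2012, Thm 2.6 p.21] -/
theorem freeProlRank_prod_eq_add (l : ℕ) [Fact l.Prime] {n : ℕ} (hn : (n : ℕ∞) ≤ freeProlRank A l)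
    (s : Finset A) (hs : (Subgroup.closure (s : Set A)).topologicalClosure = ⊤) (hcard : s.card ≤ n) :
    freeProlRank (A × B) l = freeProlRank B l + n := by
  refine le_antisymm ((freeProlRank_prod_le_add_card l s hs).trans
    (add_le_add le_rfl (by exact_mod_cast hcard))) ?_
  calc freeProlRank B l + n = (n : ℕ∞) + freeProlRank B l := add_comm _ _
    _ ≤ freeProlRank A l + freeProlRank B l := add_le_add hn le_rfl
    _ ≤ freeProlRank (A × B) l := freeProlRank_add_le_prod l

end ProductRank

/-! ### Pro-`Σ` completions: pro-`Σ`, topologically generated by the generators, rank -/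

section ProSigma

variable {P : Type v} [Group P] [TopologicalSpace P]

/-- The target of a pro-`Σ` completion is pro-`Σ` in the sense of [AbsTopI] Def 1.1 (iii)
(`IsProSet`: prime divisors of indices of open normal subgroups lie in `Σ`).
[cite: MochizukiAbsTopI2012, Def 1.1 (iii) p.10] [cite: MochizukiSemiAnbd2006, Ex. 2.10 p.31] -/
theorem isProSet_of_isProSigmaCompletion {Γ : Type u} [Group Γ] {S : Set ℕ} {ι : Γ →* P}
    (hι : IsProSigmaCompletion S ι) : IsProSet P S :=
  ⟨fun U hUn hUo q hq hdvd => (hι.index_open U hUn hUo).2 q hq hdvd⟩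

variable [IsTopologicalGroup P]

/-- The images of the `n` free generators generate a dense subgroup of a pro-`Σ` completion of
`F_n` (a generating `Finset` of cardinality `≤ n`). [cite: MochizukiSemiAnbd2006, Ex. 2.10 p.31] -/
theorem exists_finset_generators_of_isProSigmaCompletion_freeGroup {n : ℕ} {S : Set ℕ}
    {ι : FreeGroup (Fin n) →* P} (hι : IsProSigmaCompletion S ι) :
    ∃ s : Finset P, s.card ≤ n ∧ (Subgroup.closure (s : Set P)).topologicalClosure = ⊤ := by
  classical
  refine ⟨Finset.univ.image fun i : Fin n => ι (FreeGroup.of i), ?_, ?_⟩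
  · exact Finset.card_image_le.trans (by rw [Finset.card_univ, Fintype.card_fin])
  · have hcl : Subgroup.closure
        ((Finset.univ.image fun i : Fin n => ι (FreeGroup.of i) : Finset P) : Set P) = ι.range := by
      rw [Finset.coe_image, Finset.coe_univ, Set.image_univ, Set.range_comp' ι FreeGroup.of,
        ← MonoidHom.map_closure, FreeGroup.closure_range_of, ← MonoidHom.range_eq_map]
    rw [hcl, ← SetLike.coe_set_eq, Subgroup.topologicalClosure_coe, Subgroup.coe_top,
      MonoidHom.coe_range]
    exact hι.dense.closure_eq

variable [CompactSpace P]

/-- **`δ¹_l(Δ̂ × B) = δ¹_l(B) + n` for `Δ̂` a pro-`Σ` completion of `F_n` and `l ∈ Σ` prime** —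
the rank identity "`δ¹_l(Π) = δ¹_l(G) + dim_{ℚ_l}(Q_l ⊗ ℚ_l)`" of the proof of [AbsTopI] Thm 2.6
(ii) (p. 23) at the split model, with `dim Q = n`. [cite: MochizukiAbsTopI2012, Thm 2.6 (ii) p.21] -/
theorem freeProlRank_prod_eq_add_of_isProSigmaCompletion_freeGroup
    {B : Type u} [Group B] [TopologicalSpace B] [IsTopologicalGroup B] [CompactSpace B] [T2Space B]
    {n : ℕ} {S : Set ℕ} {ι : FreeGroup (Fin n) →* P} (hι : IsProSigmaCompletion S ι)
    (l : ℕ) [Fact l.Prime] (hl : l ∈ S) :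
    freeProlRank (P × B) l = freeProlRank B l + n := by
  obtain ⟨s, hcard, hs⟩ := exists_finset_generators_of_isProSigmaCompletion_freeGroup hι
  have hn : (n : ℕ∞) ≤ freeProlRank P l := by
    rw [freeProlRank_eq_card_of_isProSigmaCompletion_freeGroup hι hl,
      Fintype.card_fin]
  exact freeProlRank_prod_eq_add l hn s hs hcard

end ProSigma

namespace FundamentalExtension

open Literature.IUT.HodgeTheaters (profiniteCompletion toCompletion)

/-! ### (iv) on the model class of print: `Δ` a pro-`Σ` completion of a finitely generated group -/

/-- **[AbsTopI] Thm 2.6 (iv) AS TYPED (F-0248), instance form on the model class of print —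
`thm26iv_holds`.**  For EVERY extension `1 → Δ → Π → G → 1` with MLF base data `G ≅ G_k` whose `Δ`
is presented as a pro-`Σ` completion `ι : Γ → Δ` of a finitely generated group `Γ` (as the
"maximal pro-`Σ` quotient" `Δ_X` of a hyperbolic orbicurve is: `Γ = Γ_{g,r}`), `Σ ⊆ Primes`, the
typed (iv) holds: "every almost pro-omissive topologically finitely generated closed normal subgroup
of `Π` is contained in `Δ`; if `Σ ≠ Primes`, `Δ` is [the maximal] almost pro-omissive topologically
finitely generated closed normal subgroup" — by `MLFBase.thm26iv` (elasticity of `G_k`, Thm 1.7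
(ii), a theorem of the tree) fed with Prop 2.2 at the model (`geomTFG_of_isProSigmaCompletion`) and
"`Δ` pro-`Σ`" from the completion structure.  No hypothesis on the outer action is needed.
[cite: MochizukiAbsTopI2012, Thm 2.6 (iv) p.22] -/
theorem thm26iv_holds {E : FundamentalExtension.{0}} (B : E.MLFBase) {Γ : Type u} [Group Γ]
    [Group.FG Γ] {S : Set ℕ} {ι : Γ →* E.geom} (hι : IsProSigmaCompletion S ι)
    (hS : S ⊆ {q | q.Prime}) :
    Literature.AnabelianGeometry.AbsoluteAnabelian.FundamentalExtension.Thm26iv E S :=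
  B.thm26iv (E.geomTFG_of_isProSigmaCompletion ι hι) hS (isProSet_of_isProSigmaCompletion hι)

/-- [AbsTopI] Thm 2.6 (iv) AS TYPED on the model class of print (alias of `thm26iv_holds` under a
descriptive name). [cite: MochizukiAbsTopI2012, Thm 2.6 (iv) p.22] -/
theorem MLFBase.thm26iv_of_isProSigmaCompletion {E : FundamentalExtension.{0}} (B : E.MLFBase)
    {Γ : Type u} [Group Γ] [Group.FG Γ] {S : Set ℕ} {ι : Γ →* E.geom}
    (hι : IsProSigmaCompletion S ι) (hS : S ⊆ {q | q.Prime}) : E.Thm26iv S :=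
  thm26iv_holds B hι hS

/-- [AbsTopI] Thm 2.6 (iv) AS TYPED at the surface-group model: `Δ` a pro-`Σ` completion of
`Γ_{g,r}` (any `(g, r)`), `Σ ⊆ Primes`, MLF base. [cite: MochizukiAbsTopI2012, Thm 2.6 (iv) p.22]
[cite: MochizukiSemiAnbd2006, Ex. 2.10 p.31] -/
theorem MLFBase.thm26iv_puncturedSurfaceModel {E : FundamentalExtension.{0}} (B : E.MLFBase)
    {g r : ℕ} {S : Set ℕ}
    {ι : Literature.GroupTheory.CombinatorialGroupTheory.PuncturedSurfaceGroup g r →* E.geom}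
    (hι : IsProSigmaCompletion S ι) (hS : S ⊆ {q | q.Prime}) : E.Thm26iv S :=
  B.thm26iv (E.geomTFG_of_isProSigmaCompletion_puncturedSurfaceGroup ι hι) hS
    (isProSet_of_isProSigmaCompletion hι)

/-- **[AbsTopI] Thm 2.6 (ii) AS TYPED on the model class of print, MODULO the rank identity.**  For
every extension with MLF base data `G ≅ G_k` whose `Δ` is a pro-`Σ` completion of a finitely
generated group, GIVEN "`G` topologically finitely generated" ([NSW] Thm 7.5.10, proof p. 23 — a
theorem of the tree Summits-side, `isTopologicallyFinitelyGenerated_gal_of_mlfBase`) and the printed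
rank identity "`δ¹_l(Π) = δ¹_l(G) + dim_{ℚ_l}(Q_l ⊗ ℚ_l)` [independent of `l`] for `l ∈ Σ`" with one
`m : ℕ` (the input that DOES depend on the outer Galois action — in print from the structure of
`Δ^{ab}` as a `G`-module), the typed (ii) holds: Prop 2.2 and "`Δ` pro-`Σ`" are discharged at the
model, the rest is `thm26ii_of_isProSet_of_rank`. [cite: MochizukiAbsTopI2012, Thm 2.6 (ii) p.21] -/
theorem MLFBase.thm26ii_of_isProSigmaCompletion_of_rank {E : FundamentalExtension.{0}}
    (B : E.MLFBase) {Γ : Type u} [Group Γ] [Group.FG Γ] {S : Set ℕ} {ι : Γ →* E.geom}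
    (hι : IsProSigmaCompletion S ι) (hG : IsTopologicallyFinitelyGenerated E.gal)
    (hQ : ∃ m : ℕ, ∀ (l : ℕ) [Fact l.Prime], l ∈ S →
      freeProlRank E.arith l = freeProlRank E.gal l + m) :
    E.Thm26ii B S :=
  thm26ii_of_isProSet_of_rank B S
    (IsTopologicallyFinitelyGenerated.of_extension E.aug E.aug_surjective
      (E.geomTFG_of_isProSigmaCompletion ι hι) hG)
    (isProSet_of_isProSigmaCompletion hι) hQ

/-! ### The split model `Π := Δ̂ × G_k ↠ G_k` -/

section Split

variable (P : ProfiniteGrp.{0}) (K : Type) [Field K] [CharZero K]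

/-- In the split extension `Π := P × G_K ↠ G_K` (second projection), `Δ = P × 1`: the map
`x ↦ (x, 1)` is a continuous surjective homomorphism `P ↠ Δ`. [cite: MochizukiAbsTopI2012, Thm 2.6 p.21] -/
theorem exists_surjective_toGeom_split :
    ∃ j : P →ₜ* (⟨ProfiniteGrp.of (P × absoluteGaloisGroup K), absoluteGaloisGrp K,
        ContinuousMonoidHom.snd P (absoluteGaloisGroup K), Prod.snd_surjective⟩ :
          FundamentalExtension.{0}).geom,
      Function.Surjective j := by
  let E : FundamentalExtension.{0} := ⟨ProfiniteGrp.of (P × absoluteGaloisGroup K),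
    absoluteGaloisGrp K, ContinuousMonoidHom.snd P (absoluteGaloisGroup K), Prod.snd_surjective⟩
  have hmem : ∀ x : P × absoluteGaloisGroup K, x ∈ E.geom ↔ x.2 = 1 := fun _ => Iff.rfl
  let j : P →ₜ* E.geom :=
    { toFun := fun a => ⟨(a, 1), (hmem _).mpr rfl⟩
      map_one' := rfl
      map_mul' := fun a b => Subtype.ext (Prod.ext rfl (mul_one (1 : absoluteGaloisGroup K)).symm)
      continuous_toFun := Continuous.subtype_mk (continuous_id.prodMk continuous_const) _ }
  refine ⟨j, fun d => ?_⟩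
  have hd2 : ((d : P × absoluteGaloisGroup K)).2 = 1 := (hmem d).mp d.2
  exact ⟨(d : P × absoluteGaloisGroup K).1, Subtype.ext (Prod.ext rfl hd2.symm)⟩

/-- **[AbsTopI] Thm 2.6 (iv) AS TYPED at the split model** `Π := Δ̂ × G_K ↠ G_K`, `Δ̂` a pro-`Σ`
completion of a finitely generated group, `Σ ⊆ Primes`, `K/ℚ_p` finite: the typed (iv) holds for
`Σ` (Prop 2.2 and "pro-`Σ`" transported along `Δ̂ ↠ Δ = Δ̂ × 1`).
[cite: MochizukiAbsTopI2012, Thm 2.6 (iv) p.22] -/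
theorem thm26iv_split_of_isProSigmaCompletion {Γ : Type u} [Group Γ] [Group.FG Γ] {S : Set ℕ}
    {ι : Γ →* P} (hι : IsProSigmaCompletion S ι) (hS : S ⊆ {q | q.Prime})
    (p : ℕ) [Fact p.Prime] [Algebra ℚ_[p] K] [FiniteDimensional ℚ_[p] K] :
    Literature.AnabelianGeometry.AbsoluteAnabelian.FundamentalExtension.Thm26iv
      ⟨ProfiniteGrp.of (P × absoluteGaloisGroup K), absoluteGaloisGrp K,
        ContinuousMonoidHom.snd P (absoluteGaloisGroup K), Prod.snd_surjective⟩ S := by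
  obtain ⟨j, hj⟩ := exists_surjective_toGeom_split P K
  have hP : IsTopologicallyFinitelyGenerated P :=
    IsProSigmaCompletion.isTopologicallyFinitelyGenerated_of_fg hι
  exact MLFBase.thm26iv { p := p, K := K, galIso := ContinuousMulEquiv.refl _ }
    (hP.of_surjective j hj) hS ((isProSet_of_isProSigmaCompletion hι).of_surjective j hj)

/-- **[AbsTopI] Thm 2.6 (ii) AS TYPED at the split model** `Π := Δ̂ × G_K ↠ G_K` with `Δ̂` a
pro-`Σ` completion of the free group `F_n` (any `Σ`), MLF base datum `(p, K, refl)`, GIVEN the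
topological finite generation of `G_K` ([NSW] Thm 7.5.10, the printed input of the proof p. 23;
a theorem of the tree Summits-side, `isTopologicallyFinitelyGenerated_absoluteGaloisGroup_padic`):
"`Π` topologically finitely generated" (from `Δ̂`, `G_K`); the `G`-clauses and "`ε¹_p(Π) = ∞`"
(theorems, `thm26ii_of_clauses`); "`δ¹_l(Π) − δ¹_l(G) = 0` for `l ∉ Σ`" (`Δ` pro-`Σ`,
`freeProlRank_arith_eq_gal_of_isProSet`); "independent of `l ∈ Σ`": it is `n`
(`freeProlRank_prod_eq_add_of_isProSigmaCompletion_freeGroup`).  HONEST LABEL: a split model,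
not a curve's extension. [cite: MochizukiAbsTopI2012, Thm 2.6 (ii) p.21] -/
theorem thm26ii_split_of_isProSigmaCompletion_freeGroup {n : ℕ} {S : Set ℕ}
    {ι : FreeGroup (Fin n) →* P} (hι : IsProSigmaCompletion S ι)
    (p : ℕ) [Fact p.Prime] [Algebra ℚ_[p] K] [FiniteDimensional ℚ_[p] K]
    (hG : IsTopologicallyFinitelyGenerated (absoluteGaloisGroup K)) :
    Literature.AnabelianGeometry.AbsoluteAnabelian.FundamentalExtension.Thm26ii
      ⟨ProfiniteGrp.of (P × absoluteGaloisGroup K), absoluteGaloisGrp K,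
        ContinuousMonoidHom.snd P (absoluteGaloisGroup K), Prod.snd_surjective⟩
      { p := p, K := K, galIso := ContinuousMulEquiv.refl _ } S := by
  obtain ⟨j, hj⟩ := exists_surjective_toGeom_split P K
  have hP : IsTopologicallyFinitelyGenerated P :=
    IsProSigmaCompletion.isTopologicallyFinitelyGenerated_of_fg hι
  refine thm26ii_of_isProSet_of_rank _ S ?_ ((isProSet_of_isProSigmaCompletion hι).of_surjective j hj)
    ⟨n, fun l _ hl => ?_⟩
  · exact IsTopologicallyFinitelyGenerated.of_extension
      (ContinuousMonoidHom.snd P (absoluteGaloisGroup K)) Prod.snd_surjective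
      (hP.of_surjective j hj) hG
  · exact freeProlRank_prod_eq_add_of_isProSigmaCompletion_freeGroup hι l hl

/-- **[AbsTopI] Thm 2.6 (iv) AS TYPED at the split model with `Δ̂ = F̂_n`** (Mathlib's profinite
completion of the free group `F_n`, a pro-`Σ` completion for `Σ = Primes` — the case of
[IUTchI–III]; `F̂₂` is [EtTh]'s model of `Δ_X`), `K/ℚ_p` finite.
[cite: MochizukiAbsTopI2012, Thm 2.6 (iv) p.22] -/
theorem thm26iv_split_profiniteCompletion_freeGroup (n p : ℕ) [Fact p.Prime] [Algebra ℚ_[p] K]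
    [FiniteDimensional ℚ_[p] K] :
    Literature.AnabelianGeometry.AbsoluteAnabelian.FundamentalExtension.Thm26iv
      ⟨ProfiniteGrp.of (profiniteCompletion (FreeGroup (Fin n)) × absoluteGaloisGroup K),
        absoluteGaloisGrp K,
        ContinuousMonoidHom.snd (profiniteCompletion (FreeGroup (Fin n))) (absoluteGaloisGroup K),
        Prod.snd_surjective⟩ {q | q.Prime} :=
  thm26iv_split_of_isProSigmaCompletion (profiniteCompletion (FreeGroup (Fin n))) K
    (IsProSigmaCompletion.isProSigmaCompletion_toCompletion (FreeGroup (Fin n))) subset_rfl p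

/-- **[AbsTopI] Thm 2.6 (ii) AS TYPED at the split model with `Δ̂ = F̂_n`** (profinite completion,
`Σ = Primes`), MLF base datum `(p, K, refl)`, GIVEN `G_K` topologically finitely generated
(discharged Summits-side: `thm26ii_holds`). [cite: MochizukiAbsTopI2012, Thm 2.6 (ii) p.21] -/
theorem thm26ii_split_profiniteCompletion_freeGroup (n p : ℕ) [Fact p.Prime] [Algebra ℚ_[p] K]
    [FiniteDimensional ℚ_[p] K] (hG : IsTopologicallyFinitelyGenerated (absoluteGaloisGroup K)) :
    Literature.AnabelianGeometry.AbsoluteAnabelian.FundamentalExtension.Thm26ii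
      ⟨ProfiniteGrp.of (profiniteCompletion (FreeGroup (Fin n)) × absoluteGaloisGroup K),
        absoluteGaloisGrp K,
        ContinuousMonoidHom.snd (profiniteCompletion (FreeGroup (Fin n))) (absoluteGaloisGroup K),
        Prod.snd_surjective⟩
      { p := p, K := K, galIso := ContinuousMulEquiv.refl _ } {q | q.Prime} :=
  thm26ii_split_of_isProSigmaCompletion_freeGroup (profiniteCompletion (FreeGroup (Fin n))) K
    (IsProSigmaCompletion.isProSigmaCompletion_toCompletion (FreeGroup (Fin n))) p hG

end Split

/-! ### (i) at `Π = G = Ẑ` -/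

/-- **[AbsTopI] Thm 2.6 (i) AS TYPED (F-0246), instance form at `Π = G = Ẑ`, `Δ = 1` —
`thm26i_holds`.**  `Ẑ` = Mathlib's profinite completion of `ℤ`, free procyclic
(`isFreeProcyclic_zHatCompletion`) and `≅ Gal(k̄/k)` for every finite field `k`
(`isFreeProcyclic_absoluteGaloisGroup_of_finite`): the typed (i) — "`Π` topologically finitely
generated", "`Δ` = the common kernel of the continuous `Π → ℤ_l`", "`δ¹_l(H) = 1` for every open `H`
and every `l`" — holds at the point `X = Spec k` over a finite field (`thm26i_of_geom_eq_bot_of_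
isFreeProcyclic`).  The curve case needs `π₁` of a curve over a finite field (not in the tree).
[cite: MochizukiAbsTopI2012, Thm 2.6 (i) p.21] -/
theorem thm26i_holds :
    Literature.AnabelianGeometry.AbsoluteAnabelian.FundamentalExtension.Thm26i
      ⟨profiniteCompletion (Multiplicative ℤ), profiniteCompletion (Multiplicative ℤ),
        ContinuousMonoidHom.id _, Function.surjective_id⟩ :=
  thm26i_of_geom_eq_bot_of_isFreeProcyclic isFreeProcyclic_zHatCompletion
    ((MonoidHom.ker_eq_bot_iff _).mpr Function.injective_id)

end FundamentalExtension

end Literature.AnabelianGeometry.AbsoluteAnabelian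

end
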